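import Summits.BirchSwinnertonDyer.BirchSwinnertonDyer.Theorems.EdixhovenFibreFiveSevenLTwistTransferWitnessIrrPrep
import HarnessLib

/-!
# Transfer witness, general irreducible image — the `GL₂(𝔽_p)` argument (route `EdixhovenFibreFiveSeven`,
# crux TDS57, `--supports`; ROAD A′ part 8)

Cell `pub/bsd-wall` (D-0145 line `route-BirchSwinnertonDyer-EdixhovenFibreFiveSeven`), seat `bsd-line-edix-p3`
(prover). THEOREMS ONLY (no definition, no named fact, no `sorry`); route-free. BSD is not proved by this file.

Abstract setting (instantiated with `ρ = ρ̄_{E,p}` in a frame with complex conjugation `C = diag(1,−1)`,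
`H = Gal(ℚ̄/ℚ(μ_{4p}))`, `ζ` with `χ_{4p}(ζ) = 2p + 3`, `z = ρ(ζ)` of determinant `3`): a group `G`, a
homomorphism `ρ : G → M₂(𝔽_p)` (`p ∈ {5,7}`), a subgroup `H` containing all conjugates of its elements and all
commutators, with `det ρ = 1` on `H`, `G = ⋃ ζ^a c₀^b H`, and neither coordinate line `ρ(G)`-stable. THEOREM
(`false_of_bad`): it is impossible that every `z ρ(h)` (`h ∈ H`) has trace `±4` AND every `z C ρ(h)` has trace
`±2`. Consequently (`exists_good`) some `σ ∈ ζH ∪ ζc₀H` has `ρ(σ)` without eigenvalue `±1`. Steps: traces on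
`ρ(H)` lie in `{0, ±2}`; no unipotent `≠ 1` (a conjugate partner gives trace `4`); `ρ(H) ⊆ {±1}` forces `ρ(G)`
monomial, then diagonal — reducible; so some `j ∈ ρ(H)` has `j² = −1`; the Fricke identity gives
`3 tr(j z j z⁻¹) = −26`, whence `z` commutes with `j`; anticommuting partners are excluded by `tr(zj) ≠ 0`; so the
trace-zero part of `ρ(H)` is `{±j}`, and `C j C = ±j` leads to `tr(zC) = 0` or to a diagonal `ρ(G)` — contradiction.

References: [Serre1972] §2; [SilvermanAEC2009] III.7.
-/

set_option autoImplicit false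
-- the Theorems directory repeats the summit name (sibling precedent `SignedBaseChangeAssembly.lean`)
set_option linter.dupNamespace false

noncomputable section

open scoped Classical MatrixGroups

open Matrix

namespace Summit.BirchSwinnertonDyer.BirchSwinnertonDyer.Theorems.LTwistTransfer

/-! ### §1 More `2 × 2` algebra -/

section Algebra

variable {F : Type*} [Field F]

/-- Trace-zero `2 × 2` matrices anticommute up to the scalar `tr(XY)`: `XY + YX = tr(XY)·1`. [folklore] -/
theorem mul_add_mul_of_trace_zero (X Y : Matrix (Fin 2) (Fin 2) F) (hX : X 0 0 + X 1 1 = 0)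
    (hY : Y 0 0 + Y 1 1 = 0) :
    X * Y + Y * X = ((X * Y) 0 0 + (X * Y) 1 1) • (1 : Matrix (Fin 2) (Fin 2) F) := by
  have hX11 : X 1 1 = -X 0 0 := by linear_combination hX
  have hY11 : Y 1 1 = -Y 0 0 := by linear_combination hY
  ext i j
  fin_cases i <;> fin_cases j <;> simp [Matrix.mul_apply, Fin.sum_univ_two, hX11, hY11] <;> ring

/-- Conjugation invariance of the trace: `tr(P M P') = tr M` for `P' P = 1`. [folklore] -/
theorem trace_conj_eq (P M P' : Matrix (Fin 2) (Fin 2) F) (h : P' * P = 1) :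
    (P * M * P') 0 0 + (P * M * P') 1 1 = M 0 0 + M 1 1 := by
  rw [← Matrix.trace_fin_two, ← Matrix.trace_fin_two, Matrix.mul_assoc, Matrix.trace_mul_comm,
    Matrix.mul_assoc, h, Matrix.mul_one]

/-- For `A = b·E₁₂`: `tr(A X' A X) = b² X'₁₀ X₁₀`. [folklore] -/
theorem trace_E12 (A X X' : Matrix (Fin 2) (Fin 2) F) (h00 : A 0 0 = 0) (h10 : A 1 0 = 0) (h11 : A 1 1 = 0) :
    (A * X' * A * X) 0 0 + (A * X' * A * X) 1 1 = A 0 1 ^ 2 * X' 1 0 * X 1 0 := by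
  simp only [Matrix.mul_apply, Fin.sum_univ_two, h00, h10, h11]; ring

/-- For `A = c·E₂₁`: `tr(A X' A X) = c² X'₀₁ X₀₁`. [folklore] -/
theorem trace_E21 (A X X' : Matrix (Fin 2) (Fin 2) F) (h00 : A 0 0 = 0) (h01 : A 0 1 = 0) (h11 : A 1 1 = 0) :
    (A * X' * A * X) 0 0 + (A * X' * A * X) 1 1 = A 1 0 ^ 2 * X' 0 1 * X 0 1 := by
  simp only [Matrix.mul_apply, Fin.sum_univ_two, h00, h01, h11]; ring

/-- For trace-zero `A` and `C = diag(1,−1)`: `tr(A · CAC) = 2(A₀₀² − A₀₁A₁₀)`. [folklore] -/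
theorem trace_mul_conj_diag (A C : Matrix (Fin 2) (Fin 2) F) (hA : A 0 0 + A 1 1 = 0)
    (hC00 : C 0 0 = 1) (hC01 : C 0 1 = 0) (hC10 : C 1 0 = 0) (hC11 : C 1 1 = -1) :
    (A * (C * A * C)) 0 0 + (A * (C * A * C)) 1 1 = 2 * (A 0 0 ^ 2 - A 0 1 * A 1 0) := by
  have hA11 : A 1 1 = -A 0 0 := by linear_combination hA
  simp only [Matrix.mul_apply, Fin.sum_univ_two, hA11, hC00, hC01, hC10, hC11]; ring

/-- `X'₁₀ ≠ 0` if `X X' = 1` and `X₁₀ ≠ 0`. [folklore] -/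
theorem inv_apply_one_zero_ne_zero (X X' : Matrix (Fin 2) (Fin 2) F) (h1 : X * X' = 1)
    (hX : X 1 0 ≠ 0) : X' 1 0 ≠ 0 := by
  intro h0
  have e10 : X 1 0 * X' 0 0 + X 1 1 * X' 1 0 = 0 := by
    have := congr_fun (congr_fun h1 1) 0; simpa [Matrix.mul_apply, Fin.sum_univ_two] using this
  have e00 : X 0 0 * X' 0 0 + X 0 1 * X' 1 0 = 1 := by
    have := congr_fun (congr_fun h1 0) 0; simpa [Matrix.mul_apply, Fin.sum_univ_two] using this
  rw [h0, mul_zero, add_zero] at e10 e00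
  have hX'00 : X' 0 0 = 0 := (mul_eq_zero.mp e10).resolve_left hX
  rw [hX'00, mul_zero] at e00
  exact zero_ne_one e00

/-- `X'₀₁ ≠ 0` if `X X' = 1` and `X₀₁ ≠ 0`. [folklore] -/
theorem inv_apply_zero_one_ne_zero (X X' : Matrix (Fin 2) (Fin 2) F) (h1 : X * X' = 1)
    (hX : X 0 1 ≠ 0) : X' 0 1 ≠ 0 := by
  intro h0
  have e01 : X 0 0 * X' 0 1 + X 0 1 * X' 1 1 = 0 := by
    have := congr_fun (congr_fun h1 0) 1; simpa [Matrix.mul_apply, Fin.sum_univ_two] using this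
  have e11 : X 1 0 * X' 0 1 + X 1 1 * X' 1 1 = 1 := by
    have := congr_fun (congr_fun h1 1) 1; simpa [Matrix.mul_apply, Fin.sum_univ_two] using this
  rw [h0, mul_zero, zero_add] at e01 e11
  have hX'11 : X' 1 1 = 0 := (mul_eq_zero.mp e01).resolve_left hX
  rw [hX'11, mul_zero] at e11
  exact zero_ne_one e11

/-- Products of diagonal `2 × 2` matrices are diagonal. [folklore] -/
theorem diag_mul {P Q : Matrix (Fin 2) (Fin 2) F} (hP : P 1 0 = 0 ∧ P 0 1 = 0) (hQ : Q 1 0 = 0 ∧ Q 0 1 = 0) :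
    (P * Q) 1 0 = 0 ∧ (P * Q) 0 1 = 0 := by
  constructor <;> simp [Matrix.mul_apply, Fin.sum_univ_two, hP.1, hP.2, hQ.1, hQ.2]

/-- Powers of a diagonal `2 × 2` matrix are diagonal. [folklore] -/
theorem diag_pow {P : Matrix (Fin 2) (Fin 2) F} (hP : P 1 0 = 0 ∧ P 0 1 = 0) (k : ℕ) :
    (P ^ k) 1 0 = 0 ∧ (P ^ k) 0 1 = 0 := by
  induction k with
  | zero => simp
  | succ k ih => rw [pow_succ]; exact diag_mul ih hP

end Algebra

/-! ### §2 Numerics in `𝔽_p`, `p ∈ {5, 7}` -/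

/-- Non-vanishing numerals used below. [folklore] -/
theorem numerals_ne_zero {p : ℕ} [Fact p.Prime] (hp57 : p = 5 ∨ p = 7) :
    (2 : ZMod p) ≠ 0 ∧ (3 : ZMod p) ≠ 0 ∧ (4 : ZMod p) ≠ 0 ∧ (6 : ZMod p) ≠ 0 ∧ (26 : ZMod p) ≠ 0 ∧
      (32 : ZMod p) ≠ 0 := by
  haveI : NeZero p := ⟨(Fact.out : p.Prime).ne_zero⟩
  have key : ∀ n : ℕ, ¬ p ∣ n → ((n : ℕ) : ZMod p) ≠ 0 := fun n hn h ↦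
    hn ((ZMod.natCast_eq_zero_iff n p).mp h)
  have h2 := key 2 (by rcases hp57 with rfl | rfl <;> norm_num)
  have h3 := key 3 (by rcases hp57 with rfl | rfl <;> norm_num)
  have h4 := key 4 (by rcases hp57 with rfl | rfl <;> norm_num)
  have h6 := key 6 (by rcases hp57 with rfl | rfl <;> norm_num)
  have h26 := key 26 (by rcases hp57 with rfl | rfl <;> norm_num)
  have h32 := key 32 (by rcases hp57 with rfl | rfl <;> norm_num)
  simp only [Nat.cast_ofNat] at h2 h3 h4 h6 h26 h32
  exact ⟨h2, h3, h4, h6, h26, h32⟩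

/-! ### §3 Traces and unipotents -/

/-- **Traces and unipotents under the badness hypothesis `(A)`.** If every `z ρ(h)`, `h ∈ H`, has trace `±4`,
then every `ρ(h)` has trace in `{0, 2, −2}`, trace `2` forces `ρ(h) = 1` and trace `−2` forces `ρ(h) = −1`
(no unipotents: a conjugate partner would produce trace `4`). [cite: Serre1972, §2.6 (subgroups of GL₂(𝔽_p))] -/
theorem structure_of_bad {p : ℕ} [Fact p.Prime] (hp57 : p = 5 ∨ p = 7)
    {G : Type*} [Group G] (ρ : G →* Matrix (Fin 2) (Fin 2) (ZMod p)) (H : Subgroup G)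
    (hHn : ∀ g : G, ∀ h ∈ H, g * h * g⁻¹ ∈ H)
    (hdetH : ∀ h ∈ H, (ρ h).det = 1)
    (c₀ ζ : G) (hC : ρ c₀ = !![1, 0; 0, -1])
    (hL1 : ∃ g, ρ g 1 0 ≠ 0)
    (hA : ∀ h ∈ H, (ρ ζ * ρ h) 0 0 + (ρ ζ * ρ h) 1 1 = 4 ∨ (ρ ζ * ρ h) 0 0 + (ρ ζ * ρ h) 1 1 = -4)
    (hL2 : ∃ g, ρ g 0 1 ≠ 0) :
    (∀ h ∈ H, (ρ h) 0 0 + (ρ h) 1 1 = 0 ∨ (ρ h) 0 0 + (ρ h) 1 1 = 2 ∨ (ρ h) 0 0 + (ρ h) 1 1 = -2) ∧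
    (∀ h ∈ H, (ρ h) 0 0 + (ρ h) 1 1 = 2 → ρ h = 1) ∧
    (∀ h ∈ H, (ρ h) 0 0 + (ρ h) 1 1 = -2 → ρ h = -1) := by
  obtain ⟨h2, h3, h4, h6, h26, h32⟩ := numerals_ne_zero hp57
  set z := ρ ζ with hz
  set C := ρ c₀ with hCdef
  -- inverses
  have hinv : ∀ g : G, ρ g * ρ g⁻¹ = 1 ∧ ρ g⁻¹ * ρ g = 1 := fun g ↦
    ⟨by rw [← map_mul, mul_inv_cancel, map_one], by rw [← map_mul, inv_mul_cancel, map_one]⟩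
  have hρinv : ∀ h ∈ H, ρ h⁻¹ = ((ρ h) 0 0 + (ρ h) 1 1) • (1 : Matrix (Fin 2) (Fin 2) (ZMod p)) - ρ h := by
    intro h hh
    have h1 := mul_tr_smul_one_sub (ρ h) (hdetH h hh)
    calc ρ h⁻¹ = ρ h⁻¹ * (ρ h * (((ρ h) 0 0 + (ρ h) 1 1) • 1 - ρ h)) := by rw [h1, mul_one]
      _ = (ρ h⁻¹ * ρ h) * (((ρ h) 0 0 + (ρ h) 1 1) • 1 - ρ h) := by rw [mul_assoc]
      _ = _ := by rw [(hinv h).2, one_mul]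
  have hC00 : C 0 0 = 1 := by rw [hC]; simp
  have hC01 : C 0 1 = 0 := by rw [hC]; simp
  have hC10 : C 1 0 = 0 := by rw [hC]; simp
  have hC11 : C 1 1 = -1 := by rw [hC]; simp
  have hCC : C * C = 1 := by rw [hC]; ext i j; fin_cases i <;> fin_cases j <;> simp
  have hc₀inv : ρ c₀⁻¹ = C := by
    calc ρ c₀⁻¹ = ρ c₀⁻¹ * (C * C) := by rw [hCC, mul_one]
      _ = (ρ c₀⁻¹ * ρ c₀) * C := by rw [hCdef, mul_assoc]
      _ = C := by rw [(hinv c₀).2, one_mul]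
  -- S1: traces on `ρ(H)` lie in `{0, 2, -2}`
  have S1 : ∀ h ∈ H, (ρ h) 0 0 + (ρ h) 1 1 = 0 ∨ (ρ h) 0 0 + (ρ h) 1 1 = 2 ∨
      (ρ h) 0 0 + (ρ h) 1 1 = -2 := by
    intro h hh
    have e1 := trace_mul_add_trace_mul_adj z (ρ h)
    rw [← hρinv h hh] at e1
    have ha := hA h hh
    have hb := hA h⁻¹ (H.inv_mem hh)
    have hc := hA 1 H.one_mem
    rw [map_one, mul_one] at hc
    set t := (ρ h) 0 0 + (ρ h) 1 1
    set u := z 0 0 + z 1 1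
    rcases ha with ha | ha <;> rcases hb with hb | hb <;> rcases hc with hc | hc <;>
      rw [ha, hb, hc] at e1
    · right; left; have : (t - 2) * 4 = 0 := by linear_combination -e1
      rcases mul_eq_zero.mp this with h | h
      · exact sub_eq_zero.mp h
      · exact absurd h h4
    · right; right; have : (t + 2) * 4 = 0 := by linear_combination e1
      rcases mul_eq_zero.mp this with h | h
      · linear_combination h
      · exact absurd h h4
    · left; have : t * 4 = 0 := by linear_combination -e1
      rcases mul_eq_zero.mp this with h | h
      · exact h
      · exact absurd h h4
    · left; have : t * 4 = 0 := by linear_combination e1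
      rcases mul_eq_zero.mp this with h | h
      · exact h
      · exact absurd h h4
    · left; have : t * 4 = 0 := by linear_combination -e1
      rcases mul_eq_zero.mp this with h | h
      · exact h
      · exact absurd h h4
    · left; have : t * 4 = 0 := by linear_combination e1
      rcases mul_eq_zero.mp this with h | h
      · exact h
      · exact absurd h h4
    · right; right; have : (t + 2) * 4 = 0 := by linear_combination -e1
      rcases mul_eq_zero.mp this with h | h
      · linear_combination h
      · exact absurd h h4
    · right; left; have : (t - 2) * 4 = 0 := by linear_combination e1
      rcases mul_eq_zero.mp this with h | h
      · exact sub_eq_zero.mp h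
      · exact absurd h h4
  -- S2 core: a unipotent `1 + A ∈ ρ(H)` and a partner `1 + B ∈ ρ(H)` with `tr(AB) ≠ 0` give trace `4`
  have S2core : ∀ h₀ ∈ H, ∀ h₁ ∈ H, (ρ h₀ - 1) * (ρ h₀ - 1) = 0 →
      (ρ h₀ - 1) 0 0 + (ρ h₀ - 1) 1 1 = 0 → (ρ h₁ - 1) 0 0 + (ρ h₁ - 1) 1 1 = 0 →
      ((ρ h₀ - 1) * (ρ h₁ - 1)) 0 0 + ((ρ h₀ - 1) * (ρ h₁ - 1)) 1 1 ≠ 0 → False := by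
    intro h₀ hh₀ h₁ hh₁ hA0 htA htB hτ
    set A := ρ h₀ - 1 with hAdef
    set B := ρ h₁ - 1 with hBdef
    set τ := (A * B) 0 0 + (A * B) 1 1 with hτdef
    set k : ℕ := ((2 : ZMod p) * τ⁻¹).val with hk
    have hkF : (k : ZMod p) = 2 * τ⁻¹ := by rw [hk, ZMod.natCast_zmod_val]
    have hmem : h₀ ^ k * h₁ ∈ H := H.mul_mem (H.pow_mem hh₀ k) hh₁
    have hρ : ρ (h₀ ^ k * h₁) = (1 + (k : ZMod p) • A) * (1 + B) := by
      rw [map_mul, map_pow, show ρ h₀ = 1 + A by rw [hAdef]; abel, show ρ h₁ = 1 + B by rw [hBdef]; abel,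
        one_add_pow_of_mul_self_eq_zero A hA0 k]
    have htr := S1 _ hmem
    rw [hρ, trace_one_add_smul_mul_one_add A B htA htB, hkF, mul_assoc, inv_mul_cancel₀ hτ, mul_one] at htr
    norm_num at htr
    rcases htr with h | h | h
    · exact h4 h
    · exact h2 (by linear_combination h)
    · exact h6 (by linear_combination h)
  -- S2: no unipotent `≠ 1` in `ρ(H)`
  have S2 : ∀ h₀ ∈ H, (ρ h₀) 0 0 + (ρ h₀) 1 1 = 2 → ρ h₀ = 1 := by
    intro h₀ hh₀ htr
    by_contra hne
    set A := ρ h₀ - 1 with hAdef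
    have hA1 : ρ h₀ = 1 + A := by rw [hAdef]; abel
    have htA : A 0 0 + A 1 1 = 0 := by
      simp only [hAdef, Matrix.sub_apply, Matrix.one_apply_eq]; linear_combination htr
    have hA0 : A * A = 0 := by
      have hch := mul_self_eq_fin_two (ρ h₀)
      rw [htr, hdetH h₀ hh₀, one_smul] at hch
      rw [hAdef, Matrix.sub_mul, Matrix.mul_sub, Matrix.mul_sub, hch, Matrix.mul_one, Matrix.one_mul,
        Matrix.one_mul, two_smul]
      abel
    have hAne : A ≠ 0 := fun h0 ↦ hne (by rw [hA1, h0, add_zero])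
    have hdetA : A 0 0 ^ 2 + A 0 1 * A 1 0 = 0 := by
      have h00 := congr_fun (congr_fun hA0 0) 0
      have hA11 : A 1 1 = -A 0 0 := by linear_combination htA
      simp [Matrix.mul_apply, Fin.sum_univ_two] at h00
      linear_combination h00
    by_cases ha : A 0 0 ≠ 0
    · -- partner `C A C = ρ(c₀ h₀ c₀⁻¹) - 1`
      have hmem : c₀ * h₀ * c₀⁻¹ ∈ H := hHn c₀ h₀ hh₀
      have hB : ρ (c₀ * h₀ * c₀⁻¹) - 1 = C * A * C := by
        rw [map_mul, map_mul, hc₀inv, ← hCdef, hA1, Matrix.mul_add, Matrix.mul_one, Matrix.add_mul, hCC]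
        abel
      refine S2core h₀ hh₀ _ hmem hA0 htA ?_ ?_
      · rw [hB, trace_conj_eq C A C hCC]; exact htA
      · rw [hB, trace_mul_conj_diag A C htA hC00 hC01 hC10 hC11]
        have : A 0 0 ^ 2 - A 0 1 * A 1 0 = 2 * A 0 0 ^ 2 := by linear_combination -hdetA
        rw [this]
        exact mul_ne_zero h2 (mul_ne_zero h2 (pow_ne_zero 2 ha))
    · push Not at ha
      have hbc : A 0 1 * A 1 0 = 0 := by rw [ha] at hdetA; simpa using hdetA
      have hA11 : A 1 1 = 0 := by linear_combination htA - ha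
      rcases mul_eq_zero.mp hbc with hb | hc
      · -- `A = c E₂₁`, `c ≠ 0`; partner from a mover of `e₂`
        have hc : A 1 0 ≠ 0 := by
          intro hc; apply hAne; ext i j; fin_cases i <;> fin_cases j <;> simp [ha, hb, hc, hA11]
        obtain ⟨g, hg⟩ := hL2
        have hmem : g⁻¹ * h₀ * g⁻¹⁻¹ ∈ H := hHn g⁻¹ h₀ hh₀
        have hB : ρ (g⁻¹ * h₀ * g⁻¹⁻¹) - 1 = ρ g⁻¹ * A * ρ g := by
          rw [inv_inv, map_mul, map_mul, hA1, Matrix.mul_add, Matrix.mul_one, Matrix.add_mul, (hinv g).2]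
          abel
        refine S2core h₀ hh₀ _ hmem hA0 htA ?_ ?_
        · rw [hB, trace_conj_eq _ A _ (hinv g).1]; exact htA
        · rw [hB, ← Matrix.mul_assoc, ← Matrix.mul_assoc, trace_E21 A (ρ g) (ρ g⁻¹) ha hb hA11]
          exact mul_ne_zero (mul_ne_zero (pow_ne_zero 2 hc)
            (inv_apply_zero_one_ne_zero (ρ g) (ρ g⁻¹) (hinv g).1 hg)) hg
      · -- `A = b E₁₂`, `b ≠ 0`; partner from a mover of `e₁`
        have hb : A 0 1 ≠ 0 := by
          intro hb; apply hAne; ext i j; fin_cases i <;> fin_cases j <;> simp [ha, hb, hc, hA11]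
        obtain ⟨g, hg⟩ := hL1
        have hmem : g⁻¹ * h₀ * g⁻¹⁻¹ ∈ H := hHn g⁻¹ h₀ hh₀
        have hB : ρ (g⁻¹ * h₀ * g⁻¹⁻¹) - 1 = ρ g⁻¹ * A * ρ g := by
          rw [inv_inv, map_mul, map_mul, hA1, Matrix.mul_add, Matrix.mul_one, Matrix.add_mul, (hinv g).2]
          abel
        refine S2core h₀ hh₀ _ hmem hA0 htA ?_ ?_
        · rw [hB, trace_conj_eq _ A _ (hinv g).1]; exact htA
        · rw [hB, ← Matrix.mul_assoc, ← Matrix.mul_assoc, trace_E12 A (ρ g) (ρ g⁻¹) ha hc hA11]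
          exact mul_ne_zero (mul_ne_zero (pow_ne_zero 2 hb)
            (inv_apply_one_zero_ne_zero (ρ g) (ρ g⁻¹) (hinv g).1 hg)) hg
  -- S3: trace `-2` forces `ρ h = -1`
  have S3 : ∀ h₀ ∈ H, (ρ h₀) 0 0 + (ρ h₀) 1 1 = -2 → ρ h₀ = -1 := by
    intro h₀ hh₀ htr
    have hch := mul_self_eq_fin_two (ρ h₀)
    rw [htr, hdetH h₀ hh₀, one_smul] at hch
    have hmem : h₀ * h₀ ∈ H := H.mul_mem hh₀ hh₀
    have htr2 : (ρ (h₀ * h₀)) 0 0 + (ρ (h₀ * h₀)) 1 1 = 2 := by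
      rw [map_mul, hch]
      simp [Matrix.sub_apply, Matrix.smul_apply]
      linear_combination (-2 : ZMod p) * htr
    have h1 := S2 _ hmem htr2
    rw [map_mul, hch] at h1
    -- `-2 ρ h₀ - 1 = 1`, entrywise
    ext i j
    have hij := congr_fun (congr_fun h1 i) j
    fin_cases i <;> fin_cases j
    · simp [Matrix.sub_apply, Matrix.smul_apply] at hij ⊢
      have : (2 : ZMod p) * (ρ h₀ 0 0 + 1) = 0 := by linear_combination -hij
      have := (mul_eq_zero.mp this).resolve_left h2
      linear_combination this
    · simp [Matrix.sub_apply, Matrix.smul_apply] at hij ⊢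
      exact hij.resolve_left h2
    · simp [Matrix.sub_apply, Matrix.smul_apply] at hij ⊢
      exact hij.resolve_left h2
    · simp [Matrix.sub_apply, Matrix.smul_apply] at hij ⊢
      have : (2 : ZMod p) * (ρ h₀ 1 1 + 1) = 0 := by linear_combination -hij
      have := (mul_eq_zero.mp this).resolve_left h2
      linear_combination this
  exact ⟨S1, S2, S3⟩

end Summit.BirchSwinnertonDyer.BirchSwinnertonDyer.Theorems.LTwistTransfer

end
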